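import Literature.AlgebraicGeometry.Motives.ProductAffineChart
import Literature.AlgebraicGeometry.Motives.SmoothLocalCoordinates
import Literature.RingTheory.Etale.JacobianCriterionRingHom
import Mathlib.AlgebraicGeometry.Morphisms.Smooth
import HarnessLib

/-!
# (W0) core, chart level: the Jacobian a unit ⇒ `(pr₁, m)` is flat on the chart (S5, S6, S8, S9)

Topic `Literature/NumberTheory/DiophantineGeometry` (proofs only; no definitions, no named facts).
The chart-level half of the étale heart of the «group law on the Néron model» argument
(Bosch–Lütkebohmert–Raynaud, *Néron Models*, §4.3 proof of Prop. 6 / Edixhoven–Romagny Thm. 6.3: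
«… hence `φ` is étale at the points of `W`»), for a smooth `𝒳 → Spec R` (any commutative base
ring `R`), an open `D ⊆ 𝒳 ×_R 𝒳`, a morphism `m : D → 𝒳` over `R`, two charts
`χᵢ : Spec Bᵢ → 𝒳` over `R` (`B₂` smooth over `R`, `d y₁, …, d yₙ` a basis of `Ω[B₂⁄R]`; in the
cell `Bᵢ = Γ(𝒳, Vᵢ)` for affine opens), the product chart `c : Spec (B₁ ⊗_R B₂) → 𝒳 ×_R 𝒳`
(★ `Motives.exists_productChart`), shrunk to a basic open `Spec C`, `C = (B₁ ⊗_R B₂)_h`, on which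
`m` is given by a ring map `m♯ : B₂ → C`:

* `flat_and_locallyOfFinitePresentation_lift_of_isUnit_det` — **if the relative Jacobian
  `det (∂ m♯yᵢ / ∂ (1 ⊗ yⱼ)) ∈ C` (the determinant of `d (m♯ yᵢ)` in the basis `d (1 ⊗ yⱼ)` of
  `Ω[C⁄B₁]`) is a unit, then `Φ = (pr₁, m)` restricted to the image `W` of `Spec C` is flat and
  locally of finite presentation.**  S5: `Φ|_W ≅ Spec (φ♯) ≫ c` with
  `φ♯ = includeLeft ⊗ m♯ : B₁ ⊗_R B₂ → C` (`pullback.hom_ext`); S6: the bases `d (1 ⊗ yᵢ)` of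
  `Ω[B₁ ⊗_R B₂ ⁄ B₁]` (`KaehlerDifferential.tensorKaehlerEquiv`) and of `Ω[C⁄B₁]`
  (★ `exists_basis_kaehler_localization_eq_D`); S8: the Jacobian criterion in ring-hom form
  ★ `Literature.RingTheory.Etale.flat_specMap_of_isUnit_det_ringHom` over `k = B₁`
  (`C` is formally smooth and finitely presented over `B₁`: base change and localisation of the
  smooth `B₂ ⁄ R`); S9: transfer along the open immersions `Spec C ≅ W`, `c`.

The statement is ring-parametric (`B₁, B₂` arbitrary `R`-algebras with structure maps to `𝒳`),
which keeps the two algebra structures on `B₁ ⊗_R B₂` apart (apply with `B₁ = B₂ = Γ(𝒳, V)`);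
`algebra_smooth_sections_of_isAffineOpen` supplies the smoothness of an affine chart.
Cell `hodgecm-mathlib`, road W of `r₀` (B-p18 W0-CORE-SPEC S5–S9).

## Sources

* S. Bosch, W. Lütkebohmert, M. Raynaud, *Néron Models*, Springer 1990, §4.3 Prop. 6 (proof),
  §2.2 Prop. 11 (Jacobian criterion). [BLRNeronModels1990]
* B. Edixhoven, M. Romagny, *Group schemes out of birational group laws, Néron models*, in
  *Autour des schémas en groupes*, Panoramas et Synthèses 47 (2016), Thm. 6.3. [EdixhovenRomagny2012]
-/

noncomputable section

universe u

namespace Literature.NumberTheory.DiophantineGeometry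

open CategoryTheory Limits _root_.AlgebraicGeometry MonoidalCategory CartesianMonoidalCategory
open TensorProduct Literature.AlgebraicGeometry.Motives Literature.RingTheory.Etale

variable {R : Type u} [CommRing R] (𝒳 : Over (Spec (.of R))) (n : ℕ)

/-- **Relative differentials of a base change have the exact basis `d (1 ⊗ yᵢ)`**: if
`d y₁, …, d yₙ` is a basis of `Ω[B⁄R]`, then `d (1 ⊗ y₁), …, d (1 ⊗ yₙ)` is a basis of
`Ω[A ⊗_R B ⁄ A]` (`KaehlerDifferential.tensorKaehlerEquiv`; Bosch–Lütkebohmert–Raynaud §2.1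
Prop. 3: differentials commute with base change). [cite: BLRNeronModels1990, §2.1 Prop. 3] -/
theorem exists_basis_kaehler_baseChange_eq_D {R A B : Type u} [CommRing R] [CommRing A]
    [CommRing B] [Algebra R A] [Algebra R B] {ι : Type*} {y : ι → B}
    (bV : Module.Basis ι B Ω[B⁄R]) (hbV : ∀ i, bV i = KaehlerDifferential.D R B (y i)) :
    ∃ β : Module.Basis ι (A ⊗[R] B) Ω[A ⊗[R] B⁄A],
      ∀ i, β i = KaehlerDifferential.D A (A ⊗[R] B) ((1 : A) ⊗ₜ[R] y i) := by
  letI : Algebra B (A ⊗[R] B) := Algebra.TensorProduct.rightAlgebra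
  refine ⟨(Algebra.TensorProduct.basis (A ⊗[R] B) bV).map
    (KaehlerDifferential.tensorKaehlerEquiv R A B (A ⊗[R] B)), fun i => ?_⟩
  rw [Module.Basis.map_apply, Algebra.TensorProduct.basis_apply, hbV,
    KaehlerDifferential.tensorKaehlerEquiv_tmul_D, one_smul]
  rfl

/-- **Smoothness of an affine chart**: for a smooth `f : X → Spec R` and an affine open `V ⊆ X`
with the induced `R`-algebra structure on `Γ(X, V)`, the `R`-algebra `Γ(X, V)` is smooth
(Mathlib's `HasRingHomProperty @Smooth RingHom.Smooth` on `Spec Γ(X, V) → X → Spec R`).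
[cite: BLRNeronModels1990, §2.2 Prop. 11] -/
theorem algebra_smooth_sections_of_isAffineOpen {X : Scheme.{u}} (f : X ⟶ Spec (.of R)) [Smooth f]
    {V : X.Opens} (hV : IsAffineOpen V) [Algebra R Γ(X, V)]
    (h : algebraMap R Γ(X, V) = ((Scheme.ΓSpecIso (.of R)).inv ≫ f.appLE ⊤ V le_top).hom) :
    Algebra.Smooth R Γ(X, V) := by
  letI : Algebra R Γ((Over.mk f).left, V) := ‹Algebra R Γ(X, V)›
  have hB : hV.fromSpec ≫ f = Spec.map (CommRingCat.ofHom (algebraMap R Γ(X, V))) :=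
    fromSpec_comp_hom_eq_SpecMap_algebraMap (E := Over.mk f) hV h
  have hsm : Smooth (Spec.map (CommRingCat.ofHom (algebraMap R Γ(X, V)))) := by
    rw [← hB]; infer_instance
  exact RingHom.smooth_algebraMap.mp ((HasRingHomProperty.Spec_iff (P := @Smooth)).mp hsm)

/-- **Chart-level étale heart of (W0)** (BLR §4.3 Prop. 6 / Edixhoven–Romagny Thm. 6.3, the step
«the Jacobian is a unit, hence `(pr₁, m)` is étale there», with étale weakened to flat + locally of
finite presentation, which is what the (W0) assembly consumes).  Ring-parametric form: the two
charts are `χᵢ : Spec Bᵢ → 𝒳` over `R` (`B₂` smooth over `R`), the product chart is an open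
immersion `c : Spec (B₁ ⊗_R B₂) → 𝒳 ×_R 𝒳` compatible with `χ₁, χ₂`, `C = (B₁ ⊗_R B₂)_h`,
`ℓ : Spec C → D` the factorisation of `Spec C → 𝒳 ×_R 𝒳` through `D`, and `m♯ : B₂ → C` a ring
map with `Spec m♯ ≫ χ₂ = ℓ ≫ m`; if the relative Jacobian `α.det (d (m♯ yᵢ))` is a unit for the
(any) basis `α`, `α i = d (1 ⊗ yᵢ)`, of `Ω[C⁄B₁]`, then `(pr₁, m)` is flat and locally of finite
presentation on the image `W` of `Spec C`. [cite: BLRNeronModels1990, §4.3 Prop. 6 (proof)] -/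
theorem flat_and_locallyOfFinitePresentation_lift_of_isUnit_det
    (B₁ B₂ : Type u) [CommRing B₁] [CommRing B₂] [Algebra R B₁] [Algebra R B₂]
    [Algebra.Smooth R B₂]
    (χ₁ : Spec (.of B₁) ⟶ 𝒳.left) (χ₂ : Spec (.of B₂) ⟶ 𝒳.left)
    (hχ₁ : χ₁ ≫ 𝒳.hom = Spec.map (CommRingCat.ofHom (algebraMap R B₁)))
    (hχ₂ : χ₂ ≫ 𝒳.hom = Spec.map (CommRingCat.ofHom (algebraMap R B₂)))
    (D : (𝒳 ⊗ 𝒳).left.Opens) (m : (D : Scheme.{u}) ⟶ 𝒳.left)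
    (hm : m ≫ 𝒳.hom = D.ι ≫ (𝒳 ⊗ 𝒳).hom)
    (y : Fin n → B₂) (bV : Module.Basis (Fin n) B₂ Ω[B₂⁄R])
    (hbV : ∀ i, bV i = KaehlerDifferential.D R B₂ (y i))
    (c : Spec (.of (B₁ ⊗[R] B₂)) ⟶ (𝒳 ⊗ 𝒳).left) [IsOpenImmersion c]
    (hc₁ : c ≫ (fst 𝒳 𝒳).left =
      Spec.map (CommRingCat.ofHom Algebra.TensorProduct.includeLeftRingHom) ≫ χ₁)
    (hc₂ : c ≫ (snd 𝒳 𝒳).left =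
      Spec.map (CommRingCat.ofHom (Algebra.TensorProduct.includeRight (R := R)
        (A := B₁) (B := B₂)).toRingHom) ≫ χ₂)
    (h : B₁ ⊗[R] B₂)
    (W : (𝒳 ⊗ 𝒳).left.Opens)
    (hW : W = (Spec.map (CommRingCat.ofHom
      (algebraMap _ (Localization.Away h))) ≫ c).opensRange)
    (hWD : W ≤ D)
    (ℓ : Spec (.of (Localization.Away h)) ⟶ D)
    (hℓ : ℓ ≫ D.ι = Spec.map (CommRingCat.ofHom (algebraMap _ (Localization.Away h))) ≫ c)
    (ms : B₂ →+* Localization.Away h)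
    (hms : Spec.map (CommRingCat.ofHom ms) ≫ χ₂ = ℓ ≫ m)
    (hΔ : ∀ (α : Module.Basis (Fin n) (Localization.Away h) Ω[Localization.Away h⁄B₁]),
      (∀ i, α i = KaehlerDifferential.D B₁ _
        (algebraMap _ (Localization.Away h) ((1 : B₁) ⊗ₜ[R] y i))) →
      IsUnit (α.det fun i => KaehlerDifferential.D B₁ _ (ms (y i)))) :
    Flat (pullback.lift (W.ι ≫ (fst 𝒳 𝒳).left) ((𝒳 ⊗ 𝒳).left.homOfLE hWD ≫ m)
        (by rw [Category.assoc, Over.w (fst 𝒳 𝒳), Category.assoc, hm, ← Category.assoc,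
              Scheme.homOfLE_ι]) :
        (W : Scheme.{u}) ⟶ (𝒳 ⊗ 𝒳).left) ∧
      LocallyOfFinitePresentation (pullback.lift (W.ι ≫ (fst 𝒳 𝒳).left)
        ((𝒳 ⊗ 𝒳).left.homOfLE hWD ≫ m)
        (by rw [Category.assoc, Over.w (fst 𝒳 𝒳), Category.assoc, hm, ← Category.assoc,
              Scheme.homOfLE_ι]) :
        (W : Scheme.{u}) ⟶ (𝒳 ⊗ 𝒳).left) := by
  subst hW
  -- notation (all `let`s are transparent)
  let lh : Spec (.of (Localization.Away h)) ⟶ Spec (.of (B₁ ⊗[R] B₂)) := Spec.map (CommRingCat.ofHom (algebraMap (B₁ ⊗[R] B₂) (Localization.Away h)))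
  let cC : Spec (.of (Localization.Away h)) ⟶ (𝒳 ⊗ 𝒳).left := lh ≫ c
  haveI : IsOpenImmersion cC := inferInstanceAs (IsOpenImmersion (lh ≫ c))
  /- S5 (i): `m♯` is an `R`-algebra map: both `m♯ ∘ (R → B₂)` and `R → (Localization.Away h)` are `Spec`-dual to
  `Spec (Localization.Away h) → 𝒳 ×_R 𝒳 → Spec R`. -/
  have e1 : Spec.map (CommRingCat.ofHom (ms.comp (algebraMap R B₂))) = cC ≫ (𝒳 ⊗ 𝒳).hom := by
    rw [CommRingCat.ofHom_comp, Spec.map_comp, ← hχ₂, ← Category.assoc, hms, Category.assoc, hm,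
      ← Category.assoc, hℓ]
  have hRC : algebraMap R (Localization.Away h) =
      (algebraMap (B₁ ⊗[R] B₂) (Localization.Away h)).comp (Algebra.TensorProduct.includeLeftRingHom.comp (algebraMap R B₁)) := by
    ext r
    rw [IsScalarTower.algebraMap_apply R (B₁ ⊗[R] B₂) (Localization.Away h), RingHom.comp_apply, RingHom.comp_apply,
      Algebra.TensorProduct.includeLeftRingHom_apply, Algebra.TensorProduct.algebraMap_apply]
  have e2 : Spec.map (CommRingCat.ofHom (algebraMap R (Localization.Away h))) = cC ≫ (𝒳 ⊗ 𝒳).hom := by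
    rw [hRC, CommRingCat.ofHom_comp, CommRingCat.ofHom_comp, Spec.map_comp, Spec.map_comp,
      ← hχ₁, Category.assoc, ← reassoc_of% hc₁, Over.w (fst 𝒳 𝒳)]
  have hmsR : ms.comp (algebraMap R B₂) = algebraMap R (Localization.Away h) := by
    have := Spec.map_inj.mp (e1.trans e2.symm)
    exact congrArg CommRingCat.Hom.hom this
  let msA : B₂ →ₐ[R] (Localization.Away h) := { ms with commutes' := fun r => RingHom.congr_fun hmsR r }
  let ι₁A : B₁ →ₐ[R] (Localization.Away h) := (IsScalarTower.toAlgHom R (B₁ ⊗[R] B₂) (Localization.Away h)).comp Algebra.TensorProduct.includeLeft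
  let φ : (B₁ ⊗[R] B₂) →ₐ[R] (Localization.Away h) := Algebra.TensorProduct.productMap ι₁A msA
  have hφ₁ : φ.toRingHom.comp Algebra.TensorProduct.includeLeftRingHom =
      (algebraMap (B₁ ⊗[R] B₂) (Localization.Away h)).comp Algebra.TensorProduct.includeLeftRingHom := by
    ext b
    change φ (b ⊗ₜ[R] 1) = algebraMap (B₁ ⊗[R] B₂) (Localization.Away h) (b ⊗ₜ[R] 1)
    rw [Algebra.TensorProduct.productMap_left_apply]
    rfl
  have hφ₂ : φ.toRingHom.comp (Algebra.TensorProduct.includeRight (R := R) (A := B₁)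
      (B := B₂)).toRingHom = ms := by
    ext b
    change φ (1 ⊗ₜ[R] b) = ms b
    rw [Algebra.TensorProduct.productMap_right_apply]
    rfl
  /- S5 (ii): the KEY SQUARE `Spec (Localization.Away h) ≅ W → 𝒳 ×_R 𝒳` equals `Spec (φ♯) ≫ c`. -/
  have hℓ' : cC.isoOpensRange.hom ≫ (𝒳 ⊗ 𝒳).left.homOfLE hWD = ℓ := by
    rw [← cancel_mono D.ι, Category.assoc, Scheme.homOfLE_ι, Scheme.Hom.isoOpensRange_hom_ι, hℓ]
  have key : cC.isoOpensRange.hom ≫ pullback.lift (cC.opensRange.ι ≫ (fst 𝒳 𝒳).left)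
        ((𝒳 ⊗ 𝒳).left.homOfLE hWD ≫ m)
        (by rw [Category.assoc, Over.w (fst 𝒳 𝒳), Category.assoc, hm, ← Category.assoc,
              Scheme.homOfLE_ι]) =
      Spec.map (CommRingCat.ofHom φ.toRingHom) ≫ c := by
    apply pullback.hom_ext
    · have e : (cC.isoOpensRange.hom ≫ pullback.lift (cC.opensRange.ι ≫ (fst 𝒳 𝒳).left)
            ((𝒳 ⊗ 𝒳).left.homOfLE hWD ≫ m)
            (by rw [Category.assoc, Over.w (fst 𝒳 𝒳), Category.assoc, hm, ← Category.assoc,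
                  Scheme.homOfLE_ι])) ≫ pullback.fst 𝒳.hom 𝒳.hom = cC ≫ (fst 𝒳 𝒳).left := by
        rw [Category.assoc, pullback.lift_fst, ← Category.assoc, Scheme.Hom.isoOpensRange_hom_ι]
      rw [e]
      change lh ≫ c ≫ (fst 𝒳 𝒳).left =
        (Spec.map (CommRingCat.ofHom φ.toRingHom) ≫ c) ≫ (fst 𝒳 𝒳).left
      rw [Category.assoc, hc₁, ← Category.assoc, ← Category.assoc, ← Spec.map_comp,
        ← Spec.map_comp, ← CommRingCat.ofHom_comp, ← CommRingCat.ofHom_comp, hφ₁]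
    · have e : (cC.isoOpensRange.hom ≫ pullback.lift (cC.opensRange.ι ≫ (fst 𝒳 𝒳).left)
            ((𝒳 ⊗ 𝒳).left.homOfLE hWD ≫ m)
            (by rw [Category.assoc, Over.w (fst 𝒳 𝒳), Category.assoc, hm, ← Category.assoc,
                  Scheme.homOfLE_ι])) ≫ pullback.snd 𝒳.hom 𝒳.hom = ℓ ≫ m := by
        rw [Category.assoc, pullback.lift_snd, ← Category.assoc, hℓ']
      rw [e, ← hms]
      change _ = (Spec.map (CommRingCat.ofHom φ.toRingHom) ≫ c) ≫ (snd 𝒳 𝒳).left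
      rw [Category.assoc, hc₂, ← Category.assoc, ← Spec.map_comp, ← CommRingCat.ofHom_comp, hφ₂]
  /- S8: the ring-level hypotheses of the Jacobian criterion over `k = B₁`. -/
  haveI : Algebra.FinitePresentation (B₁ ⊗[R] B₂) (Localization.Away h) := IsLocalization.Away.finitePresentation h
  haveI : Algebra.FinitePresentation B₁ (Localization.Away h) := Algebra.FinitePresentation.trans B₁ (B₁ ⊗[R] B₂) (Localization.Away h)
  haveI : Algebra.FiniteType B₁ (B₁ ⊗[R] B₂) := inferInstance
  have hφ : φ.toRingHom.comp (algebraMap B₁ (B₁ ⊗[R] B₂)) = algebraMap B₁ (Localization.Away h) := by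
    ext b
    rw [RingHom.comp_apply, Algebra.TensorProduct.algebraMap_apply, Algebra.algebraMap_self,
      RingHom.id_apply, IsScalarTower.algebraMap_apply B₁ (B₁ ⊗[R] B₂) (Localization.Away h), Algebra.TensorProduct.algebraMap_apply,
      Algebra.algebraMap_self, RingHom.id_apply]
    exact RingHom.congr_fun hφ₁ b
  /- S6: the bases `d (1 ⊗ yᵢ)` of `Ω[(B₁ ⊗[R] B₂)⁄B₁]` and of `Ω[(Localization.Away h)⁄B₁]`. -/
  obtain ⟨β, hβ⟩ := exists_basis_kaehler_baseChange_eq_D (A := B₁) bV hbV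
  obtain ⟨α, hα⟩ := exists_basis_kaehler_localization_eq_D (Localization.Away h) (Submonoid.powers h) β hβ
  have hΔ' : IsUnit (α.det fun i => KaehlerDifferential.D B₁ (Localization.Away h) (φ.toRingHom ((1 : B₁) ⊗ₜ[R] y i))) := by
    have e : (fun i => KaehlerDifferential.D B₁ (Localization.Away h) (φ.toRingHom ((1 : B₁) ⊗ₜ[R] y i))) =
        fun i => KaehlerDifferential.D B₁ (Localization.Away h) (ms (y i)) := by
      funext i
      rw [← hφ₂]
      rfl
    rw [e]
    exact hΔ α hα
  have hflat : Flat (Spec.map (CommRingCat.ofHom φ.toRingHom)) :=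
    flat_specMap_of_isUnit_det_ringHom φ.toRingHom hφ β hβ α hΔ'
  have hlfp : LocallyOfFinitePresentation (Spec.map (CommRingCat.ofHom φ.toRingHom)) :=
    locallyOfFinitePresentation_specMap_of_isUnit_det_ringHom φ.toRingHom hφ β hβ α hΔ'
  /- S9: transfer along `Spec (Localization.Away h) ≅ W` and the open immersion `c`. -/
  have hiso : (pullback.lift (cC.opensRange.ι ≫ (fst 𝒳 𝒳).left)
        ((𝒳 ⊗ 𝒳).left.homOfLE hWD ≫ m)
        (by rw [Category.assoc, Over.w (fst 𝒳 𝒳), Category.assoc, hm, ← Category.assoc,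
              Scheme.homOfLE_ι]) : (cC.opensRange : Scheme.{u}) ⟶ (𝒳 ⊗ 𝒳).left) =
      cC.isoOpensRange.inv ≫ Spec.map (CommRingCat.ofHom φ.toRingHom) ≫ c := by
    have e := congrArg (fun g => cC.isoOpensRange.inv ≫ g) key
    simp only [Iso.inv_hom_id_assoc] at e
    exact e
  have i1 : Flat (Spec.map (CommRingCat.ofHom φ.toRingHom) ≫ c) := Flat.comp _ _
  have i2 : LocallyOfFinitePresentation (Spec.map (CommRingCat.ofHom φ.toRingHom) ≫ c) :=
    locallyOfFinitePresentation_comp _ _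
  refine ⟨?_, ?_⟩
  · rw [hiso]; exact @Flat.comp _ _ _ _ _ inferInstance i1
  · rw [hiso]; exact @locallyOfFinitePresentation_comp _ _ _ _ _ inferInstance i2

end Literature.NumberTheory.DiophantineGeometry

end
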